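import Literature.MathematicalPhysics.QuantumFieldTheory.PlaquetteWeightTorusDobrushin

/-!
# Crux `IR` (item stmt-QuantumFields-19354) — line «maximal correlation at one physical thickness»:
ONE-LINK BOUNDARY CHANGES OF THE TORUS WEIGHT SPECIFICATION ARE BOUNDED LOCAL TILTS

Helper module for item `stmt-QuantumFields-19354` (`--supports … --as helper`; it closes nothing; lead prover
ym-ir-line-mxc-p1, g2).  Supplies, for the torus weight specification `γ = torusWeightSpec v` of a continuous positive
single-plaquette weight `v` with `osc (log v) ≤ δ` (`PlaquetteWeightTorusSpecification.lean`; Wilson's action is the case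
`v = exp(−β Re tr(1 − ρ))`), the hypotheses (H1)–(H2) of the abstract maximal-correlation theorem
`HeatBath.integral_sq_kernelAvg_sub_le` (`Theorems/IR/ShellMaxCorrTransfer.lean`) and the kernel-level inputs of (H3):

* §1 the **local energy increment** `torusLogWeight v (σ^{e←s}) − torusLogWeight v σ = ∑_{q ∋ e} [log v((σ^{e←s})_q) −
  log v(σ_q)]` is bounded by `|plaqsThrough e| δ ≤ 2(d−1)δ`, reads only the links of the plaquettes through `e`, and
  is blind to every other link; hence the **tilting factor** `ρ_{e,s}(σ) = exp(that increment)` satisfies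
  `e^{−2(d−1)δ} ≤ ρ_{e,s} ≤ e^{2(d−1)δ}`, is measurable, local, and constant under updates off the plaquette
  neighbourhood of `e` (no definition is introduced: `ρ_{e,s}` is written out in every statement);
* §2 **(H2) the one-link boundary change is a tilt**: for `e ∉ Λ` and every bounded measurable `F` blind to the link `e`,
  `γ_Λ F(η^{e←s}) · γ_Λ(ρ_{e,s})(η) = γ_Λ(F ρ_{e,s})(η)` (`integral_torusWeightSpec_update_boundary`; both kernels are
  tilts of glued product Haar measures, `map_tilted_comp` + Mathlib `tilted_tilted`) — the finite form of the
  «change-of-boundary-condition identity» `⟨F⟩_{η^{e←s}} = ⟨F E⟩_η/⟨E⟩_η` (Chatterjee, CMP 385 (2021) §7 (7.2), here for the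
  torus and any compact group);
* §3 **(H1) the one-link law has density `≤ e^{2(d−1)δ}` w.r.t. Haar** (`integral_siteLaw_torusWeightSpec_le`).

HONEST FRAMING: finite-volume identities for plaquette-weight measures on tori; no statement about Dobrushin's regime,
`ShellRung`, the loads, or any mass gap is made here.

Refs: S. Chatterjee, CMP 385 (2021) 1007, §7; H.-O. Georgii, *Gibbs Measures and Phase Transitions* (2011), proof of
Prop. 8.8 (tilts of one measure); E. Seiler, LNP 159 (1982) Ch. 2.
-/

set_option autoImplicit false

noncomputable section

open MeasureTheory ProbabilityTheory Finset Function Filter Real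
open Literature.Probability.LatticeModels Literature.Probability.LatticeModels.DobrushinMetric
open Literature.MathematicalPhysics.QuantumLattice
open Literature.MathematicalPhysics.QuantumFieldTheory

namespace Summit.QuantumFields.YangMills.Cruxes.IR.ShellMaxCorr.TorusTilt

variable {d L : ℕ} [NeZero L] {G : Type*} [Group G] [TopologicalSpace G] [IsTopologicalGroup G]
  [CompactSpace G] [MeasurableSpace G] [BorelSpace G]

/-! ## §1 The local energy increment and the tilting factor -/

section Increment

omit [TopologicalSpace G] [IsTopologicalGroup G] [CompactSpace G] [MeasurableSpace G] [BorelSpace G] in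
/-- The energy increment of a one-link change is the increment of the LOCAL energy over the plaquettes through
that link. -/
theorem torusLogWeight_update_sub (v : G → ℝ) (e : Edge d L) (σ : GaugeConfig d L G) (s : G) :
    torusLogWeight v (update σ e s) - torusLogWeight v σ =
      ∑ q ∈ plaqsThrough e, (Real.log (v (plaquetteHolonomy (update σ e s) q.1 q.2.1.1 q.2.1.2)) -
        Real.log (v (plaquetteHolonomy σ q.1 q.2.1.1 q.2.1.2))) := by
  have h1 := torusLogWeight_update_eq v e σ s
  have h2 := torusLogWeight_update_eq v e σ (σ e)
  rw [update_eq_self] at h2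
  rw [h1, h2, sum_sub_distrib]
  ring

omit [TopologicalSpace G] [IsTopologicalGroup G] [CompactSpace G] [MeasurableSpace G] [BorelSpace G] in
/-- `|LW(σ^{e←s}) − LW(σ)| ≤ |plaqsThrough e| · δ` when `osc (log v) ≤ δ`. -/
theorem abs_torusLogWeight_update_sub_le {v : G → ℝ} {δ : ℝ}
    (hvδ : ∀ a b, |Real.log (v a) - Real.log (v b)| ≤ δ) (e : Edge d L) (σ : GaugeConfig d L G) (s : G) :
    |torusLogWeight v (update σ e s) - torusLogWeight v σ| ≤ (plaqsThrough e).card * δ := by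
  rw [torusLogWeight_update_sub]
  refine (abs_sum_le_sum_abs _ _).trans ?_
  calc ∑ q ∈ plaqsThrough e, |Real.log (v (plaquetteHolonomy (update σ e s) q.1 q.2.1.1 q.2.1.2)) -
          Real.log (v (plaquetteHolonomy σ q.1 q.2.1.1 q.2.1.2))|
      ≤ ∑ _q ∈ plaqsThrough e, δ := sum_le_sum fun q _ => hvδ _ _
    _ = (plaqsThrough e).card * δ := by rw [sum_const, nsmul_eq_mul]

omit [TopologicalSpace G] [IsTopologicalGroup G] [CompactSpace G] [MeasurableSpace G] [BorelSpace G] in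
/-- Uniform version: `|LW(σ^{e←s}) − LW(σ)| ≤ 2(d−1) δ`. -/
theorem abs_torusLogWeight_update_sub_le' {v : G → ℝ} {δ : ℝ}
    (hvδ : ∀ a b, |Real.log (v a) - Real.log (v b)| ≤ δ) (e : Edge d L) (σ : GaugeConfig d L G) (s : G) :
    |torusLogWeight v (update σ e s) - torusLogWeight v σ| ≤ 2 * (d - 1 : ℕ) * δ := by
  have hδ0 : 0 ≤ δ := (abs_nonneg _).trans (hvδ 1 1)
  refine (abs_torusLogWeight_update_sub_le hvδ e σ s).trans ?_
  exact_mod_cast mul_le_mul_of_nonneg_right (Nat.cast_le.2 (card_plaqsThrough_le e)) hδ0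

omit [TopologicalSpace G] [IsTopologicalGroup G] [CompactSpace G] [MeasurableSpace G] [BorelSpace G] in
/-- **Two-sided bounds on the tilting factor** `ρ_{e,s}(σ) = exp(LW(σ^{e←s}) − LW(σ))`:
`e^{−2(d−1)δ} ≤ ρ_{e,s} ≤ e^{2(d−1)δ}`. -/
theorem exp_update_sub_bounds {v : G → ℝ} {δ : ℝ}
    (hvδ : ∀ a b, |Real.log (v a) - Real.log (v b)| ≤ δ) (e : Edge d L) (s : G) (σ : GaugeConfig d L G) :
    Real.exp (-(2 * (d - 1 : ℕ) * δ)) ≤ Real.exp (torusLogWeight v (update σ e s) - torusLogWeight v σ) ∧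
      Real.exp (torusLogWeight v (update σ e s) - torusLogWeight v σ) ≤ Real.exp (2 * (d - 1 : ℕ) * δ) := by
  obtain ⟨h1, h2⟩ := abs_le.1 (abs_torusLogWeight_update_sub_le' hvδ e σ s)
  exact ⟨Real.exp_le_exp.2 h1, Real.exp_le_exp.2 h2⟩

omit [CompactSpace G] in
/-- The tilting factor is measurable (second-countable `G`, continuous `v`). -/
theorem measurable_exp_update_sub [SecondCountableTopology G] {v : G → ℝ} (hv : Continuous v)
    (e : Edge d L) (s : G) :
    Measurable fun σ : GaugeConfig d L G => Real.exp (torusLogWeight v (update σ e s) - torusLogWeight v σ) :=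
  (((measurable_torusLogWeight hv).comp measurable_update_left).sub (measurable_torusLogWeight hv)).exp

omit [TopologicalSpace G] [IsTopologicalGroup G] [CompactSpace G] [MeasurableSpace G] [BorelSpace G] in
/-- **Locality of the increment**: it is unchanged by an update at any link `e'` off the plaquette
neighbourhood `⋃_{q ∋ e} ∂q` of `e`. -/
theorem torusLogWeight_update_sub_update_of_not_mem (v : G → ℝ) {e e' : Edge d L}
    (he' : e' ∉ (plaqsThrough e).biUnion plaqEdgesT) (σ : GaugeConfig d L G) (s t : G) :
    torusLogWeight v (update (update σ e' t) e s) - torusLogWeight v (update σ e' t) =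
      torusLogWeight v (update σ e s) - torusLogWeight v σ := by
  rw [torusLogWeight_update_sub, torusLogWeight_update_sub]
  refine sum_congr rfl fun q hq => ?_
  have hq' : e' ∉ plaqEdgesT q := fun h => he' (mem_biUnion.2 ⟨q, hq, h⟩)
  have hne : e' ≠ e := by rintro rfl; exact hq' (mem_plaqsThrough.1 hq)
  rw [update_comm hne, plaquetteHolonomy_update_of_not_mem hq', plaquetteHolonomy_update_of_not_mem hq']

end Increment


omit [TopologicalSpace G] [IsTopologicalGroup G] [CompactSpace G] [MeasurableSpace G] [BorelSpace G] in
/-- **Locality of the tilting factor**, `DependsOn` form: `ρ_{e,s}` reads only the links of the plaquettes through `e`. -/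
theorem dependsOn_exp_update_sub (v : G → ℝ) (e : Edge d L) (s : G) :
    DependsOn (fun σ : GaugeConfig d L G => Real.exp (torusLogWeight v (update σ e s) - torusLogWeight v σ))
      (↑((plaqsThrough e).biUnion plaqEdgesT) : Set (Edge d L)) := by
  intro σ τ h
  simp only
  rw [torusLogWeight_update_sub, torusLogWeight_update_sub]
  congr 1
  refine sum_congr rfl fun q hq => ?_
  have hsub : ∀ z ∈ (↑(plaqEdgesT q) : Set (Edge d L)), z ∈ (↑((plaqsThrough e).biUnion plaqEdgesT) : Set (Edge d L)) :=
    fun z hz => Finset.mem_coe.2 (mem_biUnion.2 ⟨q, hq, Finset.mem_coe.1 hz⟩)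
  have hστ : plaquetteHolonomy σ q.1 q.2.1.1 q.2.1.2 = plaquetteHolonomy τ q.1 q.2.1.1 q.2.1.2 :=
    dependsOn_plaquetteHolonomy q fun z hz => h z (hsub z hz)
  have hστ' : plaquetteHolonomy (update σ e s) q.1 q.2.1.1 q.2.1.2 =
      plaquetteHolonomy (update τ e s) q.1 q.2.1.1 q.2.1.2 :=
    dependsOn_plaquetteHolonomy q fun z hz => by
      by_cases hze : z = e
      · subst hze; simp
      · rw [update_of_ne hze, update_of_ne hze]; exact h z (hsub z hz)
  rw [hστ, hστ']

/-! ## §2 (H2): a one-link boundary change tilts the kernel by `ρ_{e,s}` -/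

section Tilt

variable [SecondCountableTopology G]

omit [NeZero L] [Group G] [TopologicalSpace G] [IsTopologicalGroup G] [CompactSpace G] [MeasurableSpace G]
  [BorelSpace G] [SecondCountableTopology G] in
/-- Gluing with a boundary condition updated at an exterior link = updating the glued configuration. -/
theorem glueWith_update_of_not_mem (Λ : Finset (Edge d L)) {e : Edge d L} (he : e ∉ Λ) (ζ : ↥Λ → G)
    (η : GaugeConfig d L G) (s : G) : glueWith Λ ζ (update η e s) = update (glueWith Λ ζ η) e s := by
  funext z
  by_cases hz : z ∈ Λ
  · have hze : z ≠ e := fun h => he (h ▸ hz)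
    rw [glueWith_apply_mem _ _ _ hz, update_of_ne hze, glueWith_apply_mem _ _ _ hz]
  · by_cases hze : z = e
    · subst hze; rw [glueWith_apply_not_mem _ _ _ hz]; simp
    · rw [glueWith_apply_not_mem _ _ _ hz, update_of_ne hze, update_of_ne hze, glueWith_apply_not_mem _ _ _ hz]

/-- **The kernel with the boundary condition changed at one exterior link is a tilt of the original kernel, pushed
forward by the update**: `γ_Λ(·|η^{e←s}) = ((γ_Λ(·|η)).tilted (LW∘u − LW)).map u`, `u = (·)^{e←s}`. -/
theorem torusWeightSpec_update_boundary {v : G → ℝ} (hv : Continuous v) (hv0 : ∀ g, 0 < v g)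
    (Λ : Finset (Edge d L)) {e : Edge d L} (he : e ∉ Λ) (η : GaugeConfig d L G) (s : G) :
    torusWeightSpec v Λ (update η e s) =
      ((torusWeightSpec v Λ η).tilted fun σ => torusLogWeight v (update σ e s) - torusLogWeight v σ).map
        (update · e s) := by
  have hLW : Measurable (torusLogWeight (d := d) (L := L) v) := measurable_torusLogWeight hv
  have hu : Measurable (fun σ : GaugeConfig d L G => update σ e s) := measurable_update_left
  set P : Measure (↥Λ → G) := Measure.pi fun _ => haarProbability G with hP
  set ν : Measure (GaugeConfig d L G) := P.map (glueWith Λ · η) with hν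
  -- the glued reference measure for the new boundary condition is the push-forward of the old one by `u`
  have hglue : (fun ζ : ↥Λ → G => glueWith Λ ζ (update η e s)) = (update · e s) ∘ fun ζ => glueWith Λ ζ η := by
    funext ζ; exact glueWith_update_of_not_mem Λ he ζ η s
  have hν' : P.map (fun ζ : ↥Λ → G => glueWith Λ ζ (update η e s)) = ν.map (update · e s) := by
    rw [hglue, hν, Measure.map_map hu (measurable_glueWith Λ η)]
  -- integrability of the Boltzmann factor against the glued reference measure
  have hint : Integrable (fun σ => Real.exp (torusLogWeight v σ)) ν :=
    integrable_exp_map_glueWith_pi _ Λ η hLW (exists_abs_torusLogWeight_le hv hv0)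
  unfold torusWeightSpec
  rw [hν', ← map_tilted_comp ν hu hLW, ← hν, tilted_tilted hint]
  have hfun : (torusLogWeight v ∘ fun σ : GaugeConfig d L G => update σ e s) =
      (torusLogWeight v + fun σ => torusLogWeight v (update σ e s) - torusLogWeight v σ) := by
    funext σ; simp
  rw [hfun]

/-- **(H2), integral form.**  For `e ∉ Λ` and a bounded measurable `F` blind to the link `e`:
`γ_Λ F(η^{e←s}) · γ_Λ(ρ_{e,s})(η) = γ_Λ(F ρ_{e,s})(η)` with `ρ_{e,s}(σ) = exp(LW(σ^{e←s}) − LW(σ))`. -/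
theorem integral_torusWeightSpec_update_boundary [T2Space G] {v : G → ℝ} (hv : Continuous v)
    (hv0 : ∀ g, 0 < v g) (Λ : Finset (Edge d L)) {e : Edge d L} (he : e ∉ Λ) (η : GaugeConfig d L G) (s : G)
    {F : GaugeConfig d L G → ℝ} (hFm : Measurable F) (hF : ∀ σ t, F (update σ e t) = F σ) :
    (∫ σ, F σ ∂(torusWeightSpec v Λ (update η e s))) *
        (∫ σ, Real.exp (torusLogWeight v (update σ e s) - torusLogWeight v σ) ∂(torusWeightSpec v Λ η)) =
      ∫ σ, F σ * Real.exp (torusLogWeight v (update σ e s) - torusLogWeight v σ) ∂(torusWeightSpec v Λ η) := by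
  haveI := (isSpecification_torusWeightSpec (d := d) (L := L) hv hv0).isProbability Λ η
  have hu : Measurable (fun σ : GaugeConfig d L G => update σ e s) := measurable_update_left
  set g : GaugeConfig d L G → ℝ := fun σ => torusLogWeight v (update σ e s) - torusLogWeight v σ with hg
  -- the normaliser is positive
  have hρpos : ∀ σ, 0 < Real.exp (g σ) := fun σ => Real.exp_pos _
  have hZ : 0 < ∫ σ, Real.exp (g σ) ∂(torusWeightSpec v Λ η) := by
    obtain ⟨B, hB⟩ := exists_abs_torusLogWeight_le (d := d) (L := L) hv hv0
    have hlow : ∀ σ, Real.exp (-(B + B)) ≤ Real.exp (g σ) := fun σ => by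
      refine Real.exp_le_exp.2 ?_
      have h1 := (abs_le.1 (hB (update σ e s))).1
      have h2 := (abs_le.1 (hB σ)).2
      simp only [hg]; linarith
    have hgm : Measurable g := ((measurable_torusLogWeight hv).comp hu).sub (measurable_torusLogWeight hv)
    have hi : Integrable (fun σ => Real.exp (g σ)) (torusWeightSpec v Λ η) :=
      Integrable.of_bound hgm.exp.aestronglyMeasurable (Real.exp (B + B)) (ae_of_all _ fun σ => by
        rw [Real.norm_eq_abs, abs_of_pos (Real.exp_pos _), Real.exp_le_exp]
        have h1 := (abs_le.1 (hB (update σ e s))).2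
        have h2 := (abs_le.1 (hB σ)).1
        simp only [hg]; linarith)
    calc (0 : ℝ) < Real.exp (-(B + B)) := Real.exp_pos _
      _ = ∫ _σ, Real.exp (-(B + B)) ∂(torusWeightSpec v Λ η) := by simp
      _ ≤ ∫ σ, Real.exp (g σ) ∂(torusWeightSpec v Λ η) := integral_mono (integrable_const _) hi hlow
  rw [torusWeightSpec_update_boundary hv hv0 Λ he η s, integral_map hu.aemeasurable hFm.aestronglyMeasurable]
  simp only [hF]
  rw [integral_tilted]
  simp only [smul_eq_mul]
  have : (fun σ => Real.exp (g σ) / (∫ σ, Real.exp (g σ) ∂torusWeightSpec v Λ η) * F σ) =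
      fun σ => (∫ σ, Real.exp (g σ) ∂torusWeightSpec v Λ η)⁻¹ * (F σ * Real.exp (g σ)) := by
    funext σ; ring
  rw [this, integral_const_mul, inv_mul_eq_div, div_mul_cancel₀ _ hZ.ne']

/-- **(H2) for `Λ`-local observables** (the form consumed by `HeatBath.integral_sq_kernelAvg_sub_le`). -/
theorem integral_torusWeightSpec_update_boundary_of_dependsOn [T2Space G] {v : G → ℝ} (hv : Continuous v)
    (hv0 : ∀ g, 0 < v g) (Λ : Finset (Edge d L)) {e : Edge d L} (he : e ∉ Λ) (s : G) (η : GaugeConfig d L G)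
    (F : GaugeConfig d L G → ℝ) (hFm : Measurable F) (hF : DependsOn F (↑Λ : Set (Edge d L))) :
    (∫ σ, F σ ∂(torusWeightSpec v Λ (update η e s))) *
        (∫ σ, Real.exp (torusLogWeight v (update σ e s) - torusLogWeight v σ) ∂(torusWeightSpec v Λ η)) =
      ∫ σ, F σ * Real.exp (torusLogWeight v (update σ e s) - torusLogWeight v σ) ∂(torusWeightSpec v Λ η) :=
  integral_torusWeightSpec_update_boundary hv hv0 Λ he η s hFm fun _ _ =>
    hF fun _ hz => update_of_ne (ne_of_mem_of_not_mem (Finset.mem_coe.1 hz) he) _ _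

end Tilt

/-! ## §3 (H1): the one-link law has bounded density with respect to Haar -/

section Density

variable [SecondCountableTopology G]

/-- **(H1)**: `∫ φ dγ_e(·|η) ≤ e^{2(d−1)δ} ∫ φ dHaar` for nonnegative bounded measurable `φ` on the group — the one-link
law is Haar tilted by a local energy of oscillation `≤ 2(d−1)δ`. -/
theorem integral_siteLaw_torusWeightSpec_le {v : G → ℝ} (hv : Continuous v)
    (hv0 : ∀ g, 0 < v g) {δ : ℝ} (hvδ : ∀ a b, |Real.log (v a) - Real.log (v b)| ≤ δ) (e : Edge d L)
    (η : GaugeConfig d L G) (φ : G → ℝ) (hφm : Measurable φ) (hφ0 : ∀ g, 0 ≤ φ g) (hφb : ∃ B, ∀ g, φ g ≤ B) :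
    ∫ g, φ g ∂(siteLaw (torusWeightSpec v) e η) ≤
      Real.exp (2 * (d - 1 : ℕ) * δ) * ∫ g, φ g ∂(haarProbability G) := by
  obtain ⟨B, hB⟩ := hφb
  set E : G → ℝ := fun g => torusLogWeight v (update η e g) with hE
  have hEm : Measurable E := (measurable_torusLogWeight hv).comp (measurable_update η)
  -- oscillation of the local energy
  have hosc : ∀ a b, E a - E b ≤ 2 * (d - 1 : ℕ) * δ := fun a b => by
    have h := abs_torusLogWeight_update_sub_le' (d := d) (L := L) hvδ e (update η e b) a
    rw [update_idem] at h
    have h' := (abs_le.1 h).2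
    simp only [hE]
    linarith
  -- the normaliser dominates `exp(E a − 2(d−1)δ)` for every `a`
  obtain ⟨Bw, hBw⟩ := exists_abs_torusLogWeight_le (d := d) (L := L) hv hv0
  have hEb : ∀ g, |E g| ≤ Bw := fun g => hBw _
  have hiexp : Integrable (fun g => Real.exp (E g)) (haarProbability G) :=
    Integrable.of_bound hEm.exp.aestronglyMeasurable (Real.exp Bw) (ae_of_all _ fun g => by
      rw [Real.norm_eq_abs, abs_of_pos (Real.exp_pos _), Real.exp_le_exp]; exact (le_abs_self _).trans (hEb g))
  have hZ : ∀ a, Real.exp (E a - 2 * (d - 1 : ℕ) * δ) ≤ ∫ g, Real.exp (E g) ∂(haarProbability G) := fun a => by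
    calc Real.exp (E a - 2 * (d - 1 : ℕ) * δ) = ∫ _g, Real.exp (E a - 2 * (d - 1 : ℕ) * δ) ∂(haarProbability G) := by
          simp
      _ ≤ ∫ g, Real.exp (E g) ∂(haarProbability G) :=
          integral_mono (integrable_const _) hiexp fun g => Real.exp_le_exp.2 (by linarith [hosc a g])
  have hZpos : 0 < ∫ g, Real.exp (E g) ∂(haarProbability G) := (Real.exp_pos _).trans_le (hZ 1)
  -- density bound
  have hdens : ∀ a, Real.exp (E a) / ∫ g, Real.exp (E g) ∂(haarProbability G) ≤ Real.exp (2 * (d - 1 : ℕ) * δ) := by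
    intro a
    rw [div_le_iff₀ hZpos]
    calc Real.exp (E a) = Real.exp (2 * (d - 1 : ℕ) * δ) * Real.exp (E a - 2 * (d - 1 : ℕ) * δ) := by
          rw [← Real.exp_add]; ring_nf
      _ ≤ Real.exp (2 * (d - 1 : ℕ) * δ) * ∫ g, Real.exp (E g) ∂(haarProbability G) :=
          mul_le_mul_of_nonneg_left (hZ a) (Real.exp_pos _).le
  rw [siteLaw_torusWeightSpec_eq_tilted_haar hv e η, integral_tilted]
  simp only [smul_eq_mul]
  have hφi : Integrable φ (haarProbability G) :=
    Integrable.of_bound hφm.aestronglyMeasurable B (ae_of_all _ fun g => by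
      rw [Real.norm_eq_abs, abs_of_nonneg (hφ0 g)]; exact hB g)
  calc ∫ g, Real.exp (E g) / (∫ g, Real.exp (E g) ∂haarProbability G) * φ g ∂(haarProbability G)
      ≤ ∫ g, Real.exp (2 * (d - 1 : ℕ) * δ) * φ g ∂(haarProbability G) := by
        refine integral_mono_of_nonneg (ae_of_all _ fun g => mul_nonneg
          (div_nonneg (Real.exp_pos _).le hZpos.le) (hφ0 g)) (hφi.const_mul _)
          (ae_of_all _ fun g => mul_le_mul_of_nonneg_right (hdens g) (hφ0 g))
    _ = Real.exp (2 * (d - 1 : ℕ) * δ) * ∫ g, φ g ∂(haarProbability G) := integral_const_mul _ _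

end Density

end Summit.QuantumFields.YangMills.Cruxes.IR.ShellMaxCorr.TorusTilt

end
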